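import Mathlib
import Literature.AlgebraicGeometry.Resolution.CobordantGame
import Summits.ResolutionOfSingularities.ResolutionOfSingularities.Theorems.WeightedInvariantLocalWeightedDropTwistedTrivialXOrder
import Summits.ResolutionOfSingularities.ResolutionOfSingularities.Theorems.WeightedInvariantLocalWeightedDropTwistedTrivialWitnesses

/-!
# `WeightedInvariant.LocalWeightedDrop`: twisted triviality under CYLINDERS (§9 R4-6, rule-free part)

Route `ResolutionOfSingularities/WeightedInvariant`, crux `LocalWeightedDrop`
(stmt-ResolutionOfSingularities-8899).  [OURS · L1 W4.3] — the predicate-level content of R4-6 «cylinder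
functoriality» of ideator res-L1-w43-idea-1's `Sketch-L1-idea-1.lean` v4 §9, for the origin-fixing predicate
`GradedGame.TwistedTrivialAlongFix` (= the sketch's v4 `TwistedTrivialAlong`).  Nothing here is a statement of
the manuscript under review on ladder RESOLUTION; AI-produced, weaker than expert review.

* `cylinder F` — `F ⊗ 1 ∈ k⟦x₁..xₙ, v⟧` (sketch §9, verbatim); `subst_cylinder`, `cylinder_subst`, `coeff_cylinder`,
  `coeff_cylinder_eq_zero` — bookkeeping (the cylinder is the monomial substitution `xᵢ ↦ xᵢ`).
* `twistedTrivialAlongFix_cylinder_last` — R4-6 first conjunct, rule-free: the idle variable `v` is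
  I-saturated (`Fin.last n ∈ satSet p (cylinder F)` once `satSet` is typed).
* `twistedTrivialAlongFix_cylinder_castSucc` — R4-6 second conjunct, rule-free: every saturated axis direction
  of `F` LIFTS to `cylinder F` (`p ≠ 0`): the witness `(e, Φ, u)` of `F` lifts to
  `(e, (cylinder ∘ Φ, v), cylinder u)`.  The determinant clause is the Laplace expansion along the new last row.
The third conjunct (equality of water-filling profiles) is a statement about the §8 rule objects
(`lexmaxWeightsIn`, `profileList`), which are not in the tree; it is not addressed here.
-/

set_option linter.dupNamespace false -- mandated namespace of this single-conjunct summit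
set_option autoImplicit false

namespace Summit.ResolutionOfSingularities.ResolutionOfSingularities.Theorems

namespace GradedGame

open MvPowerSeries
open Literature.AlgebraicGeometry.Resolution

variable {k : Type} [Field k]

/-! ## The cylinder -/

/-- The cylinder `F ⊗ 1 ∈ k[[x₁..xₙ, v]]` of `F ∈ k[[x₁..xₙ]]` (idle last variable).
[OURS · L1 W4.3, Sketch-L1-idea-1 v4 §9 — VERBATIM] -/
noncomputable def cylinder {n : ℕ} (F : MvPowerSeries (Fin n) k) : MvPowerSeries (Fin (n + 1)) k :=
  subst (fun i : Fin n => (X (Fin.castSucc i) : MvPowerSeries (Fin (n + 1)) k)) F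

/-- Exponents of the cylinder family `xᵢ ↦ xᵢ` (`Fin n → Fin (n+1)` by `castSucc`). [OURS · L1 W4.3] -/
noncomputable def cylExp (n : ℕ) : Fin n → (Fin (n + 1) →₀ ℕ) := fun i => Finsupp.single (Fin.castSucc i) 1

/-- The cylinder family is the monomial family of `cylExp`. [OURS · L1 W4.3] -/
theorem cylinderFamily_eq (n : ℕ) :
    (fun i : Fin n => (X (Fin.castSucc i) : MvPowerSeries (Fin (n + 1)) k)) =
      fun i => (monomial (cylExp n i) (1 : k) : MvPowerSeries (Fin (n + 1)) k) := by
  funext i; rw [X_def]; rfl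

/-- The cylinder family is substitutable. [OURS · L1 W4.3] -/
theorem hasSubst_cylinderFamily (n : ℕ) :
    HasSubst (fun i : Fin n => (X (Fin.castSucc i) : MvPowerSeries (Fin (n + 1)) k)) :=
  hasSubst_of_constantCoeff_zero fun i => by simp [constantCoeff_X]

/-- The image exponent of the cylinder family at a new-variable index: `castSucc j ↦ d j`. [OURS · L1 W4.3] -/
theorem linExp_cylExp_castSucc {n : ℕ} (d : Fin n →₀ ℕ) (j : Fin n) :
    linExp (cylExp n) d (Fin.castSucc j) = d j := by
  classical
  rw [linExp_apply, Finsupp.sum]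
  have : ∀ v ∈ d.support, d v * cylExp n v (Fin.castSucc j) = if v = j then d v else 0 := by
    intro v _
    unfold cylExp
    by_cases hv : v = j
    · subst hv; simp
    · rw [if_neg hv, Finsupp.single_apply, if_neg (fun h => hv (Fin.castSucc_injective _ h)), mul_zero]
  rw [Finset.sum_congr rfl this, Finset.sum_ite_eq']
  split_ifs with h
  · rfl
  · exact (Finsupp.notMem_support_iff.mp h).symm

/-- The image exponent of the cylinder family vanishes at the idle variable. [OURS · L1 W4.3] -/
theorem linExp_cylExp_last {n : ℕ} (d : Fin n →₀ ℕ) : linExp (cylExp n) d (Fin.last n) = 0 := by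
  classical
  rw [linExp_apply, Finsupp.sum]
  refine Finset.sum_eq_zero fun v _ => ?_
  unfold cylExp
  rw [Finsupp.single_apply, if_neg (Fin.castSucc_lt_last v).ne, mul_zero]

/-- The exponent map of the cylinder family is injective. [OURS · L1 W4.3] -/
theorem linExp_cylExp_injective (n : ℕ) : Function.Injective (linExp (cylExp n)) := by
  intro d d' h
  ext j
  have := congrArg (fun θ => θ (Fin.castSucc j)) h
  simpa only [linExp_cylExp_castSucc] using this

/-- The image exponent of `x^{eⱼ}` is `x^{e_{castSucc j}}`. [OURS · L1 W4.3] -/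
theorem linExp_cylExp_single {n : ℕ} (j : Fin n) (r : ℕ) :
    linExp (cylExp n) (Finsupp.single j r) = Finsupp.single (Fin.castSucc j) r := by
  unfold linExp cylExp
  rw [Finsupp.sum_single_index (by simp), Finsupp.smul_single, smul_eq_mul, mul_one]

/-- Coefficients of the cylinder at image exponents are those of `F`. [OURS · L1 W4.3] -/
theorem coeff_cylinder {n : ℕ} (F : MvPowerSeries (Fin n) k) (d : Fin n →₀ ℕ) :
    coeff (linExp (cylExp n) d) (cylinder F) = coeff d F := by
  have hS := hasSubst_cylinderFamily (k := k) n
  unfold cylinder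
  rw [cylinderFamily_eq] at hS ⊢
  exact coeff_linExp_subst_monomial (cylExp n) hS (linExp_cylExp_injective n) F d

/-- The cylinder does not involve the idle variable. [OURS · L1 W4.3] -/
theorem coeff_cylinder_eq_zero {n : ℕ} (F : MvPowerSeries (Fin n) k) (μ : Fin (n + 1) →₀ ℕ)
    (hμ : μ (Fin.last n) ≠ 0) : coeff μ (cylinder F) = 0 := by
  have hS := hasSubst_cylinderFamily (k := k) n
  unfold cylinder
  rw [cylinderFamily_eq] at hS ⊢
  refine coeff_subst_monomial_eq_zero (cylExp n) hS F μ fun d h => hμ ?_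
  rw [← h, linExp_cylExp_last]

/-- Substituting into a cylinder ignores the value at the idle variable. [OURS · L1 W4.3] -/
theorem subst_cylinder {n m : ℕ} {G : Fin (n + 1) → MvPowerSeries (Fin m) k} (hG : HasSubst G)
    (F : MvPowerSeries (Fin n) k) : subst G (cylinder F) = subst (fun j => G (Fin.castSucc j)) F := by
  unfold cylinder
  rw [subst_comp_subst_apply (hasSubst_cylinderFamily n) hG]
  congr 1
  funext j
  rw [subst_X hG]

/-- The cylinder of a substitution is the substitution of the cylinders. [OURS · L1 W4.3] -/
theorem cylinder_subst {n m : ℕ} {T : Fin n → MvPowerSeries (Fin m) k} (hT : HasSubst T)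
    (F : MvPowerSeries (Fin n) k) : cylinder (subst T F) = subst (fun j => cylinder (T j)) F := by
  unfold cylinder
  rw [subst_comp_subst_apply hT (hasSubst_cylinderFamily m)]

/-- The cylinder is multiplicative. [OURS · L1 W4.3] -/
theorem cylinder_mul {n : ℕ} (F G : MvPowerSeries (Fin n) k) : cylinder (F * G) = cylinder F * cylinder G := by
  unfold cylinder
  rw [subst_mul (hasSubst_cylinderFamily n)]

/-- The cylinder of a variable. [OURS · L1 W4.3] -/
theorem cylinder_X {n : ℕ} (i : Fin n) : cylinder (X i : MvPowerSeries (Fin n) k) = X (Fin.castSucc i) := by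
  unfold cylinder
  rw [subst_X (hasSubst_cylinderFamily n)]

/-- The cylinder is a ring map: it preserves units. [OURS · L1 W4.3] -/
theorem isUnit_cylinder {n : ℕ} {u : MvPowerSeries (Fin n) k} (hu : IsUnit u) : IsUnit (cylinder u) :=
  isUnit_subst (hasSubst_cylinderFamily n) hu

/-- The cylinder of a series with zero constant term has zero constant term. [OURS · L1 W4.3] -/
theorem constantCoeff_cylinder_eq_zero {n : ℕ} {G : MvPowerSeries (Fin n) k} (hG : constantCoeff G = 0) :
    constantCoeff (cylinder G) = 0 :=
  constantCoeff_subst_eq_zero (hasSubst_cylinderFamily n) (fun i => by simp [constantCoeff_X]) hG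

/-! ## R4-6, first conjunct: the idle variable is saturated -/

/-- R4-6 (first conjunct, rule-free): the cylinder `F ⊗ 1` is twisted-trivial along the idle `v`-axis in the
origin-fixing sense (honestly: `Φ = id`), for every `p`. [OURS · L1 W4.3, Sketch-L1-idea-1 v4 §9 R4-6] -/
theorem twistedTrivialAlongFix_cylinder_last (p : ℕ) {n : ℕ} (F : MvPowerSeries (Fin n) k) :
    TwistedTrivialAlongFix p (cylinder F) (axisCurve (Fin.last n)) :=
  twistedTrivialAlongFix_axis_of_idle p (cylinder F) (Fin.last n) fun d hd => by
    by_contra h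
    exact hd (coeff_cylinder_eq_zero F d h)

/-! ## R4-6, second conjunct: saturated directions lift to the cylinder -/

/-- Linear coefficients of a cylinder: at a lifted variable they are those of the original series. [OURS · L1 W4.3] -/
theorem coeff_single_castSucc_cylinder {n : ℕ} (G : MvPowerSeries (Fin n) k) (j : Fin n) :
    coeff (Finsupp.single (Fin.castSucc j) 1) (cylinder G) = coeff (Finsupp.single j 1) G := by
  rw [← linExp_cylExp_single, coeff_cylinder]

/-- Linear coefficients of a cylinder: at the idle variable they vanish. [OURS · L1 W4.3] -/
theorem coeff_single_last_cylinder {n : ℕ} (G : MvPowerSeries (Fin n) k) :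
    coeff (Finsupp.single (Fin.last n) 1) (cylinder G) = 0 :=
  coeff_cylinder_eq_zero G _ (by simp)

/-- R4-6 (second conjunct, rule-free) — SATURATED DIRECTIONS LIFT TO THE CYLINDER: if `F` is twisted-trivial along
the `xᵢ`-axis in the origin-fixing sense, so is `F ⊗ 1` (`p ≠ 0`).  The witness `(e, Φ, u)` of `F` lifts to
`(e, (cylinder ∘ Φ, v), cylinder u)`. [OURS · L1 W4.3, Sketch-L1-idea-1 v4 §9 R4-6] -/
theorem twistedTrivialAlongFix_cylinder_castSucc (p : ℕ) (hp : p ≠ 0) {n : ℕ} (F : MvPowerSeries (Fin n) k)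
    (i : Fin n) (h : TwistedTrivialAlongFix p F (axisCurve i)) :
    TwistedTrivialAlongFix p (cylinder F) (axisCurve (Fin.castSucc i)) := by
  classical
  obtain ⟨-, e, Φ, u, hu, hΦ0, hfix, hdet, heq⟩ := h
  have hpe : p ^ e ≠ 0 := pow_ne_zero e hp
  have hΦs : HasSubst Φ := hasSubst_of_constantCoeff_zero hΦ0
  -- the translation families of `F` (level `n`) and of `cylinder F` (level `n + 1`)
  have ha : HasSubst (fun _ : Fin 1 => (X (0 : Fin (n + 1)) : MvPowerSeries (Fin (n + 1)) k) ^ (p ^ e)) :=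
    hasSubst_of_constantCoeff_zero fun _ => by simp [constantCoeff_X, zero_pow hpe]
  have ha' : HasSubst (fun _ : Fin 1 => (X (0 : Fin (n + 1 + 1)) : MvPowerSeries (Fin (n + 1 + 1)) k) ^ (p ^ e)) :=
    hasSubst_of_constantCoeff_zero fun _ => by simp [constantCoeff_X, zero_pow hpe]
  set T : Fin n → MvPowerSeries (Fin (n + 1)) k := fun j => X j.succ +
    subst (fun _ : Fin 1 => (X (0 : Fin (n + 1)) : MvPowerSeries (Fin (n + 1)) k) ^ (p ^ e)) (axisCurve (k := k) i j)
    with hT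
  have hTj : ∀ j, T j = X j.succ + if j = i then X 0 ^ (p ^ e) else 0 := by
    intro j
    simp only [hT, axisCurve]
    by_cases hj : j = i
    · rw [if_pos hj, if_pos hj, subst_X ha]
    · rw [if_neg hj, if_neg hj, ← coe_substAlgHom ha, map_zero]
  have hTs : HasSubst T := hasSubst_of_constantCoeff_zero fun j => by
    rw [hTj]; by_cases hj : j = i <;> simp [hj, constantCoeff_X, zero_pow hpe]
  set T' : Fin (n + 1) → MvPowerSeries (Fin (n + 1 + 1)) k := fun w => X w.succ +
    subst (fun _ : Fin 1 => (X (0 : Fin (n + 1 + 1)) : MvPowerSeries (Fin (n + 1 + 1)) k) ^ (p ^ e))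
      (axisCurve (k := k) (Fin.castSucc i) w) with hT'
  have hT'w : ∀ w, T' w = X w.succ + if w = Fin.castSucc i then X 0 ^ (p ^ e) else 0 := by
    intro w
    simp only [hT', axisCurve]
    by_cases hw : w = Fin.castSucc i
    · rw [if_pos hw, if_pos hw, subst_X ha']
    · rw [if_neg hw, if_neg hw, ← coe_substAlgHom ha', map_zero]
  have hT's : HasSubst T' := hasSubst_of_constantCoeff_zero fun w => by
    rw [hT'w]; by_cases hw : w = Fin.castSucc i <;> simp [hw, constantCoeff_X, zero_pow hpe]
  -- `T'` restricted to the old variables is the cylinder of `T`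
  have hcyl := hasSubst_cylinderFamily (k := k) (n + 1)
  have hT'T : ∀ j, T' (Fin.castSucc j) = cylinder (T j) := by
    intro j
    by_cases hj : j = i
    · subst hj
      rw [hT'w, hTj, if_pos rfl, if_pos rfl, cylinder, subst_add hcyl, subst_X hcyl, subst_pow hcyl, subst_X hcyl]
      rfl
    · rw [hT'w, hTj, if_neg (fun h => hj (Fin.castSucc_injective _ h)), if_neg hj, cylinder, subst_add hcyl,
        subst_X hcyl, ← coe_substAlgHom hcyl, map_zero]
      rfl
  -- the lifted witness
  set Φ' : Fin (n + 1) → MvPowerSeries (Fin (n + 1 + 1)) k :=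
    Fin.snoc (fun j => cylinder (Φ j)) (X (Fin.last n).succ) with hΦ'
  have hΦ's : HasSubst Φ' := hasSubst_of_constantCoeff_zero fun w => by
    refine Fin.lastCases ?_ (fun j => ?_) w
    · simp only [hΦ', Fin.snoc_last]; simp [constantCoeff_X]
    · simp only [hΦ', Fin.snoc_castSucc]; exact constantCoeff_cylinder_eq_zero (hΦ0 j)
  refine ⟨fun w => ?_, e, Φ', cylinder u, isUnit_cylinder hu, fun w => ?_, fun w => ?_, ?_, ?_⟩
  · unfold axisCurve; split_ifs <;> simp [constantCoeff_X]
  · refine Fin.lastCases ?_ (fun j => ?_) w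
    · simp only [hΦ', Fin.snoc_last]; simp [constantCoeff_X]
    · simp only [hΦ', Fin.snoc_castSucc]; exact constantCoeff_cylinder_eq_zero (hΦ0 j)
  · -- origin-fixing: the kill-`x` map commutes with the cylinder
    have hK' := hasSubst_keep (k := k) (fun v : Fin (n + 1 + 1) => v = 0)
    have hK'eq : (fun v : Fin (n + 1 + 1) => if v = 0 then (X (0 : Fin (n + 1 + 1)) : MvPowerSeries (Fin (n + 1 + 1)) k)
        else 0) = fun v : Fin (n + 1 + 1) => if v = 0 then (X v : MvPowerSeries (Fin (n + 1 + 1)) k) else 0 := by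
      funext v; by_cases hv : v = 0 <;> simp [hv]
    rw [hK'eq]
    refine Fin.lastCases ?_ (fun j => ?_) w
    · simp only [hΦ', Fin.snoc_last]
      rw [subst_X hK']
      simp
    · simp only [hΦ', Fin.snoc_castSucc]
      rw [cylinder, subst_comp_subst_apply (hasSubst_cylinderFamily (n + 1)) hK']
      have hfam : (fun s : Fin (n + 1) => subst (fun v : Fin (n + 1 + 1) =>
            if v = 0 then (X v : MvPowerSeries (Fin (n + 1 + 1)) k) else 0)
            (X (Fin.castSucc s) : MvPowerSeries (Fin (n + 1 + 1)) k)) =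
          fun s => cylinder (if s = 0 then (X (0 : Fin (n + 1)) : MvPowerSeries (Fin (n + 1)) k) else 0) := by
        funext s
        rw [subst_X hK']
        by_cases hs : s = 0
        · subst hs; simp [cylinder_X]
        · rw [if_neg (fun h => hs (Fin.castSucc_eq_zero_iff.mp h)), if_neg hs, cylinder,
            ← coe_substAlgHom (hasSubst_cylinderFamily (n + 1)), map_zero]
      have hKs := hasSubst_keep (k := k) (fun v : Fin (n + 1) => v = 0)
      have hKeq : (fun v : Fin (n + 1) => if v = 0 then (X (0 : Fin (n + 1)) : MvPowerSeries (Fin (n + 1)) k) else 0) =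
          fun v : Fin (n + 1) => if v = 0 then (X v : MvPowerSeries (Fin (n + 1)) k) else 0 := by
        funext v; by_cases hv : v = 0 <;> simp [hv]
      rw [hfam, ← cylinder_subst (hKeq ▸ hKs), hfix j, cylinder, ← coe_substAlgHom (hasSubst_cylinderFamily (n + 1)),
        map_zero]
  · -- the determinant: Laplace expansion along the new last row
    set M : Matrix (Fin n) (Fin n) k := Matrix.of fun a b => coeff (Finsupp.single b.succ 1) (Φ a) with hM
    set M' : Matrix (Fin (n + 1)) (Fin (n + 1)) k := Matrix.of fun a b => coeff (Finsupp.single b.succ 1) (Φ' a)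
      with hM'
    have hlast : ∀ b, M' (Fin.last n) b = if b = Fin.last n then 1 else 0 := by
      intro b
      simp only [hM', Matrix.of_apply, hΦ', Fin.snoc_last, coeff_X]
      by_cases hb : b = Fin.last n
      · subst hb; simp
      · rw [if_neg hb, if_neg]
        intro h'
        exact hb (Fin.succ_injective _ ((Finsupp.single_left_inj one_ne_zero).mp h'))
    have hsub : M'.submatrix (Fin.last n).succAbove (Fin.last n).succAbove = M := by
      ext a b
      simp only [Matrix.submatrix_apply, Fin.succAbove_last, hM', hM, Matrix.of_apply, hΦ', Fin.snoc_castSucc]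
      rw [Fin.succ_castSucc]
      exact coeff_single_castSucc_cylinder (Φ a) b.succ
    have hdet' : M'.det = M.det := by
      rw [Matrix.det_succ_row M' (Fin.last n), Finset.sum_eq_single (Fin.last n)]
      · rw [hlast, if_pos rfl, hsub, mul_one, Even.neg_one_pow ⟨(Fin.last n : ℕ), rfl⟩, one_mul]
      · intro b _ hb
        rw [hlast, if_neg hb, mul_zero, zero_mul]
      · intro h; exact absurd (Finset.mem_univ _) h
    change IsUnit M'.det
    rw [hdet']
    exact hdet
  · -- the identity: apply `cylinder` to the witness identity of `F`
    change subst T' (cylinder F) = cylinder u * subst Φ' (cylinder F)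
    rw [subst_cylinder hT's, subst_cylinder hΦ's]
    have h1 : (fun j => T' (Fin.castSucc j)) = fun j => cylinder (T j) := funext hT'T
    have h2 : (fun j => Φ' (Fin.castSucc j)) = fun j => cylinder (Φ j) := by
      funext j; simp only [hΦ', Fin.snoc_castSucc]
    rw [h1, h2, ← cylinder_subst hTs, ← cylinder_subst hΦs, ← cylinder_mul]
    exact congrArg cylinder heq

end GradedGame

end Summit.ResolutionOfSingularities.ResolutionOfSingularities.Theorems
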